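import Summits.QuantumFields.YangMills.Theorems.BalabanUVNodesN15KingModelJetLettersColour
import HarnessLib

/-!
# N15 (NE2) — PROGRAMME K, part K-B: ★★★ THE η-DEFECT OF THE WHOLE FIRST-ORDER DRESSED JET OF KING's FULL `A = 0` PROPAGATOR `⊗ 1` — VALUE AND GRADIENT COMPONENTS — HYPOTHESIS-FREE,
# WITH NO LETTER ON `∇c′` AND NO FIT OF `c′`: III-B ★★★ `hasMaj_idef_bgPair_of_sandwichRows` FIRED ON THE KING RUNG (all nine rows = K-A ★ `kingJet_uniform_letters`)

WHO ∕ WHEN.  Cell `pub-ymgap`, seat `pub-ymgap-dag-n15-a` (KNIT-BY-NAME seat of Track-A DAG node N15 = NE2, g25); `--kind proof --supports stmt-QuantumFields-27366 --as helper` (K3⁸;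
count-neutral).  THEOREMS ONLY (0 `def`).  Over K-A `…KingModelJetLettersColour` (★ `kingJet_uniform_letters`: Σ-a∕Σ-d letters ⊗ 1, M-C, dag-n15-d (S1′) ★), III-B `…TwoGridDressedJetNoFitC`
(★★★ `hasMaj_idef_bgPair_of_sandwichRows`, ★★ `hasMaj_projO_idef_bgPair`), `B6UnitTorusCarrier.rowSum_unitTorusGeo` BY NAME; nothing in the tree is modified.  Trigger: dag-n15-d g20 «KNIT (go)»
(INBOX l.42374).

WHAT.  §3 `jetKing_const_bound` (constants against the two Neumann guards).  §4 ★★★ `hasMaj_idef_bgPair_kingJet`: for `d ≥ 1`, odd `L ≥ 3` (stated `Odd L`, `2 ≤ L`), `a > 0`, `m₀² ≥ 0`, `0 ≤ γ < 1`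
there are `δ, r₀, B > 0` such that for EVERY coarse level `K ≥ 1`, refinement `n ≥ 1`, cube `M_μ = 2L^e`, mass `0 < m² ≤ m₀²`, every `0 ≤ r ≤ r₀`, `o_a ≥ 0` and every fine first-order family
`(c′, a′_μ)` on the `(K+n)`-level 1-forms with `|c′|, |a′_μ| ≤ r` and fit of `a′` to its King block averages `≤ o_a`:
`HasMaj (King coarse blocks) (fine unit blocks ⊔ jet index) (𝔇_{(kingPrV, liftPair kingPrV)}(bgPair (A₀′⁻¹⊗1) (ρ(N′(s_μ−1))(A₀′⁻¹⊗1))_μ c′ a′, bgPair (A₀⁻¹⊗1) (ρ(N(s_μ−1))(A₀⁻¹⊗1))_μ c̄ ā))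
(B·((L^K)^{−γ∕2} + r·(K+2)∕L^K + o_a)·e^{−δ|y−y′|_T})`, `c̄, ā` the block averages — the η-defect of the WHOLE dressed jet `(X, ∇_μX)`, `X = (1 − (A₀⁻¹⊗1)(M_c + ΣM_{a_μ}N∇_μ))⁻¹(A₀⁻¹⊗1)`
(n15-b's stacked (3.65) fixed point), with the `c′`-defect never fitted: under the front `A₀′⁻¹ ⊗ 1` it is M-C's divergence-form row (one factor `L^{−K}`), under the fronts `ρ(N′(s_ν−1))(A₀′⁻¹ ⊗ 1)`
it is dag-n15-d's cell-oscillation row (`(K+2)L^{−K}`, uniform in `n`).  ★★ `hasMaj_projO_idef_bgPair_kingJet`: every component, in particular THE DRESSED GRADIENT ENTRY `𝔇(∇′_νX′, ∇_νX)`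
(`j = some ν`) and the value entry (`j = none`).
HONEST FRAMING ∕ LIMITS.  Count-neutral assembly BY NAME of LANDED rows; King's `A = 0` MODEL on finite tori (template literature [King1986]), NOT Bałaban's `G(U)` ((S3) located: no level∕profile rows
for `Δ_a⁻¹` in the tree); abelianised scalar-multiplier model of (3.52)'s `V′(A)`, block-averaged coarse partner (C3); the letters consumed on `(c′, a′)` are sups and ONE fit of `a′` (derivable
from `|∇′a′|`, II-E) — NOTHING on `∇c′`; NE2⁺ NOT printed ∕ NOT proved; no statement of record touched; N15 NOT discharged; K3⁸ OPEN; counts UNMOVED (typed 28∕28 · discharged 5∕27); one finite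
torus per index — NOT ℝ⁴ ∕ infinite volume ∕ OS ∕ mass gap ∕ Clay.
-/

noncomputable section

open scoped BigOperators
open Finset

namespace Summit.QuantumFields.YangMills.BalabanUVNodes.N15.TwoGrid.KingJet

open Literature.MathematicalPhysics.QuantumFieldTheory.Balaban1983to89
open Literature.MathematicalPhysics.QuantumFieldTheory.Balaban1983to89.B11SectG (BlockNorm HasMaj)
open Literature.MathematicalPhysics.QuantumFieldTheory.Balaban1983to89.T4EtaRateDefect (idef)
open Literature.MathematicalPhysics.QuantumFieldTheory.Balaban1983to89.T4EtaRateCoeffDefect (pull blockAvg)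
open Literature.MathematicalPhysics.QuantumFieldTheory.Balaban1983to89.B5Prop11Plancherel (Tor fine unitVec)
open Literature.MathematicalPhysics.QuantumFieldTheory.King1986.Torus (blockOf tdistT tdistT_nonneg)
open Literature.MathematicalPhysics.QuantumFieldTheory.Balaban1983to89.B6UnitTorusCarrier (unitTorusGeo rowSum_unitTorusGeo)
open Summit.QuantumFields.YangMills.BalabanUVNodes.N15.VectorPiece (kingPrV blkFine tensorId)
open Summit.QuantumFields.YangMills.BalabanUVNodes.N15KingModelRung.Curved (kingGOp)
open Summit.QuantumFields.YangMills.BalabanUVNodes.N15.BackgroundLayer (projO liftPair blkPair bgPair)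

variable {d : ℕ} (L : ℕ) [NeZero L]

/-! ## §3 Constants against the two Neumann guards -/

omit [NeZero L] in
/-- III-B's total constant at `m_G = βθ`, `ζ₀ = βrx`, `ζ = βrt`, `B_X = 2β`, both inverse guards `≤ 2`, `r ≤ r₀`, `x ≤ t`: `≤ B·(θ + rt + o_a)`,
`B = 2βc_r + 4β²c_rr₀(s+2) + 8β²c_r(s+1)·(1 + 1) + 1`. [folklore] -/
theorem jetKing_const_bound {β cr θ r r₀ x t oa s q₁ q₂ : ℝ} (hβ : 0 ≤ β) (hcr : 0 ≤ cr) (hθ : 0 ≤ θ) (hr : 0 ≤ r) (hrr₀ : r ≤ r₀) (hx : 0 ≤ x) (hxt : x ≤ t) (hoa : 0 ≤ oa)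
    (hs : 0 ≤ s) (hq₁ : 0 ≤ q₁) (hq₁2 : q₁ ≤ 2) (hq₂ : 0 ≤ q₂) (hq₂2 : q₂ ≤ 2) :
    (β * θ * cr + 1 * (β * θ * cr) * (r * (s + 2) * (β * q₁)) + ((β * r * x + (s + 1) * (β * oa)) * (2 * β) * cr + (β * r * t + (s + 1) * (β * oa)) * (2 * β) * cr)) * q₂
      ≤ (2 * β * cr + 4 * β ^ 2 * cr * r₀ * (s + 2) + 16 * β ^ 2 * cr * (s + 1) + 8 * β ^ 2 * cr + 1) * (θ + r * t + oa) := by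
  have hr₀ : 0 ≤ r₀ := hr.trans hrr₀
  have ht : 0 ≤ t := hx.trans hxt
  have hrt : 0 ≤ r * t := mul_nonneg hr ht
  have s1 : β * θ * cr * q₂ ≤ 2 * β * cr * θ := by nlinarith [mul_nonneg (mul_nonneg hβ hθ) hcr]
  have s2 : 1 * (β * θ * cr) * (r * (s + 2) * (β * q₁)) * q₂ ≤ 4 * β ^ 2 * cr * r₀ * (s + 2) * θ := by
    have h1 : r * (s + 2) * (β * q₁) ≤ r₀ * (s + 2) * (β * 2) :=
      mul_le_mul (mul_le_mul_of_nonneg_right hrr₀ (by linarith)) (mul_le_mul_of_nonneg_left hq₁2 hβ) (by positivity) (by positivity)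
    have h0 : 0 ≤ β * θ * cr := by positivity
    calc 1 * (β * θ * cr) * (r * (s + 2) * (β * q₁)) * q₂ ≤ 1 * (β * θ * cr) * (r₀ * (s + 2) * (β * 2)) * 2 :=
          mul_le_mul (mul_le_mul_of_nonneg_left h1 (by positivity)) hq₂2 hq₂ (by positivity)
      _ = 4 * β ^ 2 * cr * r₀ * (s + 2) * θ := by ring
  have s3 : (β * r * x + (s + 1) * (β * oa)) * (2 * β) * cr * q₂ ≤ 4 * β ^ 2 * cr * (r * t) + 4 * β ^ 2 * cr * (s + 1) * oa := by
    have h1 : β * r * x ≤ β * (r * t) := by nlinarith [mul_le_mul_of_nonneg_left hxt hr]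
    have h0 : 0 ≤ (β * r * x + (s + 1) * (β * oa)) * (2 * β) * cr := by positivity
    calc (β * r * x + (s + 1) * (β * oa)) * (2 * β) * cr * q₂ ≤ (β * (r * t) + (s + 1) * (β * oa)) * (2 * β) * cr * 2 :=
          mul_le_mul (mul_le_mul_of_nonneg_right (mul_le_mul_of_nonneg_right (by linarith) (by positivity)) hcr) hq₂2 hq₂ (by positivity)
      _ = 4 * β ^ 2 * cr * (r * t) + 4 * β ^ 2 * cr * (s + 1) * oa := by ring
  have s4 : (β * r * t + (s + 1) * (β * oa)) * (2 * β) * cr * q₂ ≤ 4 * β ^ 2 * cr * (r * t) + 4 * β ^ 2 * cr * (s + 1) * oa := by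
    have h0 : 0 ≤ (β * r * t + (s + 1) * (β * oa)) * (2 * β) * cr := by positivity
    calc (β * r * t + (s + 1) * (β * oa)) * (2 * β) * cr * q₂ ≤ (β * r * t + (s + 1) * (β * oa)) * (2 * β) * cr * 2 := mul_le_mul_of_nonneg_left hq₂2 h0
      _ = 4 * β ^ 2 * cr * (r * t) + 4 * β ^ 2 * cr * (s + 1) * oa := by ring
  have hsum : (β * θ * cr + 1 * (β * θ * cr) * (r * (s + 2) * (β * q₁)) + ((β * r * x + (s + 1) * (β * oa)) * (2 * β) * cr + (β * r * t + (s + 1) * (β * oa)) * (2 * β) * cr)) * q₂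
      = β * θ * cr * q₂ + 1 * (β * θ * cr) * (r * (s + 2) * (β * q₁)) * q₂ + ((β * r * x + (s + 1) * (β * oa)) * (2 * β) * cr * q₂ + (β * r * t + (s + 1) * (β * oa)) * (2 * β) * cr * q₂) := by
    ring
  rw [hsum]
  nlinarith [mul_nonneg (mul_nonneg hβ hcr) hθ, mul_nonneg (mul_nonneg hβ hcr) hrt, mul_nonneg (mul_nonneg hβ hcr) hoa, mul_nonneg (mul_nonneg (mul_nonneg (sq_nonneg β) hcr) hr₀) hθ,
    mul_nonneg (mul_nonneg (sq_nonneg β) hcr) hθ, mul_nonneg (mul_nonneg (sq_nonneg β) hcr) hrt, mul_nonneg (mul_nonneg (sq_nonneg β) hcr) hoa,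
    mul_nonneg (mul_nonneg (mul_nonneg (sq_nonneg β) hcr) hs) hoa, mul_nonneg (mul_nonneg (mul_nonneg (sq_nonneg β) hcr) hs) hθ,
    mul_nonneg (mul_nonneg (mul_nonneg (sq_nonneg β) hcr) hs) hrt, mul_nonneg (mul_nonneg (mul_nonneg (sq_nonneg β) hcr) hr₀) hrt,
    mul_nonneg (mul_nonneg (mul_nonneg (sq_nonneg β) hcr) hr₀) hoa, mul_nonneg (mul_nonneg (mul_nonneg (mul_nonneg (sq_nonneg β) hcr) hr₀) hs) hθ,
    mul_nonneg (mul_nonneg (mul_nonneg (mul_nonneg (sq_nonneg β) hcr) hr₀) hs) hrt, mul_nonneg (mul_nonneg (mul_nonneg (mul_nonneg (sq_nonneg β) hcr) hr₀) hs) hoa]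

/-! ## §4 ★★★ The whole dressed jet, hypothesis-free on the King rung -/

variable (d)

/-- ★★★ **THE η-DEFECT OF THE WHOLE FIRST-ORDER DRESSED JET OF KING's FULL `A = 0` PROPAGATOR `⊗ 1`, HYPOTHESIS-FREE, NO LETTER ON `∇c′`, NO FIT OF `c′`.**  See the module docstring (WHAT).
III-B at `σ = ρ := δ∕2`, `m_G := β(L^K)^{−γ∕2}`, `ζ₀ := βr(L^K)⁻¹` (M-C), `ζ := βr(K+2)∕L^K` (dag-n15-d (S1′)), `B_X := 2β`, window `r₀ := (2β(d+2)c_r + 1)⁻¹` (both Neumann guards `≤ ½`).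
[cite: Balaban1985BackgroundPropagators, (3.35) p.396 (letters), (3.52) p.400, (3.62)–(3.65) pp.402–403 (mechanism), Thm 3.1 (3.42) p.397 (entries 0–1: shape); King1986, (2.13)–(2.17) p.653,
Prop. 3.8 (3.71) p.664, Prop. 3.9 (3.73) p.665, p.664 (pairing), (4.42) p.675 (levels); Balaban1984PropagatorsII, Lemma 2.1 (2.61) p.234] -/
theorem hasMaj_idef_bgPair_kingJet (hd : 1 ≤ d) (hLodd : Odd L) (hL : 2 ≤ L) {a : ℝ} (ha : 0 < a) {m0sq : ℝ} (hm0 : 0 ≤ m0sq) {γ : ℝ} (hγ0 : 0 ≤ γ) (hγ1 : γ < 1) :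
    ∃ δ r₀ B : ℝ, 0 < δ ∧ 0 < r₀ ∧ 0 < B ∧ ∀ (K : ℕ), 1 ≤ K → ∀ (n : ℕ), 1 ≤ n → ∀ (e : ℕ) (M : Fin (d + 1) → ℕ) [∀ μ, NeZero (M μ)], (∀ μ, M μ = 2 * L ^ e) →
      ∀ (msq : ℝ), 0 < msq → msq ≤ m0sq → ∀ (r : ℝ), 0 ≤ r → r ≤ r₀ → ∀ (oa : ℝ), 0 ≤ oa →
      ∀ (c' : Tor (fine (L ^ n * L ^ K) M) × Fin (d + 1) → ℝ) (a' : Fin (d + 1) → Tor (fine (L ^ n * L ^ K) M) × Fin (d + 1) → ℝ),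
      (∀ z, |c' z| ≤ r) → (∀ μ z, |a' μ z| ≤ r) → (∀ μ z, |a' μ z - blockAvg (kingPrV L K n M) (a' μ) (kingPrV L K n M z)| ≤ oa) →
      HasMaj (BlockNorm.ofBlocks (unitTorusGeo L K M) (blkFine L K M))
        (BlockNorm.ofBlocks (unitTorusGeo L K M) (blkPair fun i : Tor (fine (L ^ n * L ^ K) M) × Fin (d + 1) => blockOf (L ^ n * L ^ K) M i.1))
        (idef (pull (kingPrV L K n M)) (pull (liftPair (J := Fin (d + 1)) (kingPrV L K n M)))
          (bgPair (tensorId (Fin (d + 1)) (kingGOp L a msq (K + n) (L ^ n * L ^ K) M))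
            (fun μ => symbOp M (L ^ n * L ^ K) (sD M (L ^ n * L ^ K) μ ((L ^ n * L ^ K : ℕ) : ℝ)) ∘ₗ tensorId (Fin (d + 1)) (kingGOp L a msq (K + n) (L ^ n * L ^ K) M)) c' a')
          (bgPair (tensorId (Fin (d + 1)) (kingGOp L a msq K (L ^ K) M))
            (fun μ => symbOp M (L ^ K) (sD M (L ^ K) μ ((L ^ K : ℕ) : ℝ)) ∘ₗ tensorId (Fin (d + 1)) (kingGOp L a msq K (L ^ K) M))
            (blockAvg (kingPrV L K n M) c') (fun μ => blockAvg (kingPrV L K n M) (a' μ))))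
        (fun y y' => B * (((L : ℝ) ^ K) ^ (-(γ / 2)) + r * ((((K : ℕ) : ℝ) + 2) / (L : ℝ) ^ K) + oa) * Real.exp (-(δ * tdistT M y y'))) := by
  obtain ⟨δ₀, β, hδ₀, hβ, H⟩ := kingJet_uniform_letters d L hd hLodd hL ha hm0 hγ0 hγ1
  have hσ : 0 < δ₀ / 2 := by positivity
  set cr : ℝ := B4Sect5Proof.latticeConst (d + 1) (δ₀ / 2) with hcr_def
  have hcr : 0 ≤ cr := B4Sect5Proof.latticeConst_nonneg (d + 1) hσ.le
  set W : ℝ := β * ((d : ℝ) + 2) * cr with hW_def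
  have hW : 0 ≤ W := by positivity
  have hr₀ : 0 < (2 * W + 1)⁻¹ := by positivity
  set r₀ : ℝ := (2 * W + 1)⁻¹ with hr₀_def
  refine ⟨δ₀ / 2, r₀, 2 * β * cr + 4 * β ^ 2 * cr * r₀ * ((d : ℝ) + 2) + 16 * β ^ 2 * cr * ((d : ℝ) + 1) + 8 * β ^ 2 * cr + 1, hσ, hr₀, by positivity, ?_⟩
  intro K hK n hn e M _ hM msq hmsq hcap r hr hrr₀ oa hoa c' a' hc' ha' hfa
  obtain ⟨hG, hGD, hG', hG'D, hDG, hDD, hrows⟩ := H K hK n hn e M hM msq hmsq hcap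
  obtain ⟨hGc, hDGc⟩ := hrows c' r hr hc'
  have hLr : (0 : ℝ) < (L : ℝ) := by exact_mod_cast (show 0 < L by omega)
  have hLK : (0 : ℝ) < (L : ℝ) ^ K := pow_pos hLr K
  have hθ : 0 ≤ ((L : ℝ) ^ K) ^ (-(γ / 2)) := Real.rpow_nonneg hLK.le _
  have hx : 0 ≤ (((L ^ K : ℕ) : ℝ))⁻¹ := inv_nonneg.mpr (Nat.cast_nonneg _)
  have hxt : (((L ^ K : ℕ) : ℝ))⁻¹ ≤ (((K : ℕ) : ℝ) + 2) / (L : ℝ) ^ K := by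
    rw [Nat.cast_pow, inv_eq_one_div]
    exact div_le_div_of_nonneg_right (by have := (Nat.cast_nonneg K : (0 : ℝ) ≤ K); linarith) hLK.le
  -- the two guards: `q = β(r(d+2))c_r ≤ r₀W ≤ ½`
  have h1 : r₀ * (2 * W + 1) = 1 := inv_mul_cancel₀ (by positivity)
  have hr₀W : r₀ * W ≤ 1 / 2 := by nlinarith [hr₀.le]
  have hqle : β * (r * ((d : ℝ) + 2)) * cr ≤ r₀ * W := by
    calc β * (r * ((d : ℝ) + 2)) * cr = r * (β * ((d : ℝ) + 2) * cr) := by ring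
      _ ≤ r₀ * (β * ((d : ℝ) + 2) * cr) := mul_le_mul_of_nonneg_right hrr₀ (by positivity)
      _ = r₀ * W := by rw [hW_def]
  have hq : β * (r * ((d : ℝ) + 2)) * cr < 1 := by linarith
  have hq0 : 0 ≤ (1 - β * (r * ((d : ℝ) + 2)) * cr)⁻¹ := inv_nonneg.mpr (by linarith)
  have hq2 : (1 - β * (r * ((d : ℝ) + 2)) * cr)⁻¹ ≤ 2 := by
    calc (1 - β * (r * ((d : ℝ) + 2)) * cr)⁻¹ ≤ (1 / 2)⁻¹ := inv_anti₀ (by norm_num) (by linarith)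
      _ = 2 := by norm_num
  have hBX : β * (1 - β * (r * ((d : ℝ) + 2)) * cr)⁻¹ ≤ 2 * β := by nlinarith [mul_le_mul_of_nonneg_left hq2 hβ.le]
  have hq0' : 0 ≤ (1 - 1 * (β * (r * ((d : ℝ) + 2)) * cr))⁻¹ := by rw [one_mul]; exact hq0
  have hq2' : (1 - 1 * (β * (r * ((d : ℝ) + 2)) * cr))⁻¹ ≤ 2 := by rw [one_mul]; exact hq2
  -- III-B
  have key := hasMaj_idef_bgPair_of_sandwichRows M K n hσ.le hcr (rowSum_unitTorusGeo L K M hσ) (ρ := δ₀ / 2) (δ := δ₀) hσ.le (by linarith) hβ.le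
    (mul_nonneg hβ.le hθ) hr hoa (mul_nonneg (mul_nonneg hβ.le hr) hx) (mul_nonneg (mul_nonneg hβ.le hr) (hx.trans hxt)) (BX := 2 * β)
    hG hGD hG' hG'D hDG hDD hGc hDGc hc' ha' hfa hq hBX
  have hbd := jetKing_const_bound (s := (d : ℝ)) hβ.le hcr hθ hr hrr₀ hx hxt hoa (Nat.cast_nonneg d) hq0 hq2 hq0' hq2'
  refine key.mono fun y y' => ?_
  have hE := Real.exp_nonneg (-(δ₀ / 2 * tdistT M y y'))
  exact mul_le_mul_of_nonneg_right hbd hE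

/-- ★★ **EVERY COMPONENT OF THE DRESSED JET — IN PARTICULAR THE DRESSED GRADIENT ENTRY `𝔇(∇′_νX′, ∇_νX)` (`j = some ν`) AND THE VALUE ENTRY `𝔇(X′, X)` (`j = none`) — HYPOTHESIS-FREE ON THE
KING RUNG**, same constants (III-B ★★ `hasMaj_projO_idef_bgPair`). [cite: Balaban1985BackgroundPropagators, Thm 3.1 (3.42) p.397 (entries 0 and 1: shape), (3.62)–(3.65) pp.402–403 (mechanism);
King1986, Prop. 3.9 (3.73) p.665 (rate factor)] -/
theorem hasMaj_projO_idef_bgPair_kingJet (hd : 1 ≤ d) (hLodd : Odd L) (hL : 2 ≤ L) {a : ℝ} (ha : 0 < a) {m0sq : ℝ} (hm0 : 0 ≤ m0sq) {γ : ℝ} (hγ0 : 0 ≤ γ) (hγ1 : γ < 1) :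
    ∃ δ r₀ B : ℝ, 0 < δ ∧ 0 < r₀ ∧ 0 < B ∧ ∀ (K : ℕ), 1 ≤ K → ∀ (n : ℕ), 1 ≤ n → ∀ (e : ℕ) (M : Fin (d + 1) → ℕ) [∀ μ, NeZero (M μ)], (∀ μ, M μ = 2 * L ^ e) →
      ∀ (msq : ℝ), 0 < msq → msq ≤ m0sq → ∀ (r : ℝ), 0 ≤ r → r ≤ r₀ → ∀ (oa : ℝ), 0 ≤ oa →
      ∀ (c' : Tor (fine (L ^ n * L ^ K) M) × Fin (d + 1) → ℝ) (a' : Fin (d + 1) → Tor (fine (L ^ n * L ^ K) M) × Fin (d + 1) → ℝ),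
      (∀ z, |c' z| ≤ r) → (∀ μ z, |a' μ z| ≤ r) → (∀ μ z, |a' μ z - blockAvg (kingPrV L K n M) (a' μ) (kingPrV L K n M z)| ≤ oa) → ∀ (j : Option (Fin (d + 1))),
      HasMaj (BlockNorm.ofBlocks (unitTorusGeo L K M) (blkFine L K M))
        (BlockNorm.ofBlocks (unitTorusGeo L K M) (fun i : Tor (fine (L ^ n * L ^ K) M) × Fin (d + 1) => blockOf (L ^ n * L ^ K) M i.1))
        (idef (pull (kingPrV L K n M)) (pull (kingPrV L K n M))
          (projO j ∘ₗ bgPair (tensorId (Fin (d + 1)) (kingGOp L a msq (K + n) (L ^ n * L ^ K) M))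
            (fun μ => symbOp M (L ^ n * L ^ K) (sD M (L ^ n * L ^ K) μ ((L ^ n * L ^ K : ℕ) : ℝ)) ∘ₗ tensorId (Fin (d + 1)) (kingGOp L a msq (K + n) (L ^ n * L ^ K) M)) c' a')
          (projO j ∘ₗ bgPair (tensorId (Fin (d + 1)) (kingGOp L a msq K (L ^ K) M))
            (fun μ => symbOp M (L ^ K) (sD M (L ^ K) μ ((L ^ K : ℕ) : ℝ)) ∘ₗ tensorId (Fin (d + 1)) (kingGOp L a msq K (L ^ K) M))
            (blockAvg (kingPrV L K n M) c') (fun μ => blockAvg (kingPrV L K n M) (a' μ))))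
        (fun y y' => B * (((L : ℝ) ^ K) ^ (-(γ / 2)) + r * ((((K : ℕ) : ℝ) + 2) / (L : ℝ) ^ K) + oa) * Real.exp (-(δ * tdistT M y y'))) := by
  obtain ⟨δ, r₀, B, hδ, hr₀, hB, H⟩ := hasMaj_idef_bgPair_kingJet d L hd hLodd hL ha hm0 hγ0 hγ1
  exact ⟨δ, r₀, B, hδ, hr₀, hB, fun K hK n hn e M _ hM msq hmsq hcap r hr hrr₀ oa hoa c' a' hc' ha' hfa j =>
    hasMaj_projO_idef_bgPair M K n (H K hK n hn e M hM msq hmsq hcap r hr hrr₀ oa hoa c' a' hc' ha' hfa) j⟩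

end Summit.QuantumFields.YangMills.BalabanUVNodes.N15.TwoGrid.KingJet

end
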